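import Literature.Topology.FourManifolds.SmoothOrientationProofs
import Literature.Topology.FourManifolds.SmoothOrientationSphereProofs
import Literature.AlgebraicTopology.FundamentalGroup.SphereSimplyConnected
import HarnessLib

/-!
# Smooth orientations exist at the route parameters (carrier witnesses for `SmoothOrientation`)

Carrier-census witnesses (D-0034, libB) for the structure
`Literature.Topology.FourManifolds.SmoothOrientation I M` of smooth orientations of a `C¹` manifold
(`SmoothOrientation.lean`). The bare census statement `∀ I M, Nonempty (SmoothOrientation I M)`
is **false** — it says that every manifold is orientable, and the tree already proves
`¬ IsOrientable (𝓡 4) (RealProjectiveSpace 4)`, i.e. `IsEmpty (SmoothOrientation (𝓡 4) ℝℙ⁴)`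
(`Summit.SmoothPoincare4.SmoothPoincare4.Theorems.OrigamiFoldExistence.Negative.not_isOrientable_realProjectiveFour`,
a `Summits/` file, hence not importable here). What the routes quantify over is inhabited, and
unconditionally so, by results already in the tree which this file merely assembles:

* `SmoothOrientation_nonempty` — **every simply connected `C¹` manifold** (any real model with
  corners) carries a smooth orientation: the discharged fact
  `isOrientable_of_simplyConnectedSpace_holds` (`SmoothOrientationProofs.lean`, orientation
  double cover; Lee, *Introduction to Smooth Manifolds*, 2nd ed., Thm. 15.43 with Prop. 15.40).
  This covers the carrier `SmoothOrientation (𝓡 4) N` of the `CommonDualRelay` items, whose binder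
  block assumes `[SimplyConnectedSpace N]`; registered as an instance.
* `SmoothOrientation_nonempty_sphere` — **every standard sphere** `𝕊ⁿ ⊂ ℝⁿ⁺¹`: the discharged
  fact `isOrientable_sphere_holds` (`SmoothOrientationSphereProofs.lean`; Hirsch, *Differential
  Topology*, §4.4). This covers the carrier
  `SmoothOrientation (𝓡 2) (Metric.sphere (0 : EuclideanSpace ℝ (Fin 3)) 1)` literally
  (`SmoothOrientation_nonempty_sphereTwo`); registered as instances.
* `SmoothOrientation_nonempty_modelSpace` — **every normed space** `F` as a manifold modelled on
  itself (`𝓘(ℝ, F)`; in particular `𝓡 n` on `EuclideanSpace ℝ (Fin n)`): the constant orientation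
  `SmoothOrientation.modelSpace` (in infinite dimension `finrank = 0` and a `Fin 0`-indexed
  orientation still exists, `nonempty_orientation`); registered as an instance.
* `exists_oriented_closed_simplyConnected_four` — the *whole* binder block of those items,
  "`N` closed (compact, `T2`, second countable), simply connected, `IsManifold (𝓡 4) ∞`, with
  `oN : SmoothOrientation (𝓡 4) N`", is jointly inhabited, by `N = 𝕊⁴`
  (`simplyConnectedSpace_euclideanSphere`, Hatcher Prop. 1.14).

Sources: J. M. Lee, *Introduction to Smooth Manifolds*, 2nd ed. (GTM 218, 2013), Thm. 15.43,
Prop. 15.40, Example 15.22; M. W. Hirsch, *Differential Topology* (GTM 33, 1976), §4.4;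
A. Hatcher, *Algebraic Topology* (2002), Prop. 1.14. Nothing new is proved here; the emptiness
region (non-orientable `M`, e.g. `ℝℙ⁴`) is deliberately not restated in `Literature/`.
-/

open scoped Manifold ContDiff Topology

namespace Literature.Topology.FourManifolds

section SimplyConnected

variable {E H : Type*} [NormedAddCommGroup E] [NormedSpace ℝ E] [TopologicalSpace H]
  {I : ModelWithCorners ℝ E H}
  {M : Type*} [TopologicalSpace M] [ChartedSpace H M] [IsManifold I 1 M]

/-- **Carrier witness (simply connected manifolds).** Every simply connected `C¹` manifold `M`,
for any real model with corners `I`, carries a smooth orientation: the orientation double cover is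
trivial over a simply connected, locally path connected base (Lee, *Introduction to Smooth
Manifolds*, 2nd ed., Thm. 15.43; discharged in the tree as
`isOrientable_of_simplyConnectedSpace_holds`). In particular the carrier
`SmoothOrientation (𝓡 4) N` of the `SmoothPoincare4` routes (`N` simply connected) is inhabited.
[cite: LeeSmoothManifolds2013, Thm. 15.43] -/
theorem SmoothOrientation_nonempty [SimplyConnectedSpace M] : Nonempty (SmoothOrientation I M) :=
  isOrientable_of_simplyConnectedSpace_holds (I := I) (M := M)

/-- Instance form of `SmoothOrientation_nonempty`: a simply connected manifold has
`Nonempty (SmoothOrientation I M)`. [cite: LeeSmoothManifolds2013, Thm. 15.43] -/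
instance instNonemptySmoothOrientationOfSimplyConnectedSpace [SimplyConnectedSpace M] :
    Nonempty (SmoothOrientation I M) :=
  SmoothOrientation_nonempty

/-- `IsOrientable` form: a simply connected manifold is orientable (restatement of the discharged
fact with the instance argument explicit, for `simp`/term use). [cite: LeeSmoothManifolds2013, Thm. 15.43] -/
theorem isOrientable_of_simplyConnected [SimplyConnectedSpace M] : IsOrientable I M :=
  SmoothOrientation_nonempty

end SimplyConnected

section Spheres

/-- **Carrier witness (spheres).** Every standard sphere `𝕊ⁿ ⊂ ℝⁿ⁺¹` carries a smooth
orientation for Mathlib's stereographic atlas (Hirsch, *Differential Topology*, §4.4, `Sⁿ = ∂Dⁿ⁺¹`;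
Lee, Example 15.22; discharged in the tree as `isOrientable_sphere_holds`).
[cite: HirschDT1976, §4.4 p. 101] -/
theorem SmoothOrientation_nonempty_sphere (n : ℕ) :
    Nonempty (SmoothOrientation (𝓡 n) (Metric.sphere (0 : EuclideanSpace ℝ (Fin (n + 1))) 1)) :=
  isOrientable_sphere_holds n

/-- Instance form of `SmoothOrientation_nonempty_sphere`. [cite: HirschDT1976, §4.4 p. 101] -/
instance instNonemptySmoothOrientationSphere (n : ℕ) :
    Nonempty (SmoothOrientation (𝓡 n) (Metric.sphere (0 : EuclideanSpace ℝ (Fin (n + 1))) 1)) :=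
  SmoothOrientation_nonempty_sphere n

/-- The literal route carrier `SmoothOrientation (𝓡 2) (Metric.sphere (0 : EuclideanSpace ℝ (Fin 3)) 1)`
(the `oS`, `oP`, `o` binders of the `CommonDualRelay` items) is inhabited.
[cite: HirschDT1976, §4.4 p. 101] -/
theorem SmoothOrientation_nonempty_sphereTwo :
    Nonempty (SmoothOrientation (𝓡 2) (Metric.sphere (0 : EuclideanSpace ℝ (Fin 3)) 1)) :=
  SmoothOrientation_nonempty_sphere 2

/-- Instance form of `SmoothOrientation_nonempty_sphereTwo`, keyed on the literal spelling
`Fin 3` used by the routes. [cite: HirschDT1976, §4.4 p. 101] -/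
instance instNonemptySmoothOrientationSphereTwo :
    Nonempty (SmoothOrientation (𝓡 2) (Metric.sphere (0 : EuclideanSpace ℝ (Fin 3)) 1)) :=
  SmoothOrientation_nonempty_sphereTwo

end Spheres

section ModelSpace

/-- **Carrier witness (model spaces).** A normed space `F`, as a manifold modelled on itself,
carries a smooth orientation: the constant one (`SmoothOrientation.modelSpace`) with value any
orientation of `F` (`nonempty_orientation`; Hirsch, *Differential Topology*, §4.4, Example).
No finite-dimensionality is needed. [folklore] -/
theorem SmoothOrientation_nonempty_modelSpace (F : Type*) [NormedAddCommGroup F]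
    [NormedSpace ℝ F] : Nonempty (SmoothOrientation 𝓘(ℝ, F) F) :=
  (nonempty_orientation F).map SmoothOrientation.modelSpace

/-- Instance form of `SmoothOrientation_nonempty_modelSpace` (covers `𝓡 n` on
`EuclideanSpace ℝ (Fin n)`, `𝓡 n = 𝓘(ℝ, EuclideanSpace ℝ (Fin n))`). [folklore] -/
instance instNonemptySmoothOrientationModelSpace {F : Type*} [NormedAddCommGroup F]
    [NormedSpace ℝ F] : Nonempty (SmoothOrientation 𝓘(ℝ, F) F) :=
  SmoothOrientation_nonempty_modelSpace F

/-- Euclidean space `EuclideanSpace ℝ (Fin n)` with the model `𝓡 n` carries a smooth orientation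
(the standard one, `SmoothOrientation.euclidean`). [folklore] -/
theorem SmoothOrientation_nonempty_euclidean (n : ℕ) :
    Nonempty (SmoothOrientation (𝓡 n) (EuclideanSpace ℝ (Fin n))) :=
  ⟨SmoothOrientation.euclidean n⟩

end ModelSpace

section Context

open scoped ContDiff in
/-- **Context witness** for the `SmoothPoincare4` route items: the whole binder block
"`N : Type` with `TopologicalSpace`, `T2Space`, `SecondCountableTopology`,
`ChartedSpace (EuclideanSpace ℝ (Fin 4))`, `IsManifold (𝓡 4) ∞`, `CompactSpace`,
`SimplyConnectedSpace`, and a smooth orientation `oN : SmoothOrientation (𝓡 4) N`" is jointly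
inhabited, by `N = 𝕊⁴` (compact; simply connected by Hatcher, *Algebraic Topology*, Prop. 1.14,
`simplyConnectedSpace_euclideanSphere`; oriented by `isOrientable_sphere_holds`). [folklore] -/
theorem exists_oriented_closed_simplyConnected_four :
    ∃ (N : Type) (_ : TopologicalSpace N) (_ : T2Space N) (_ : SecondCountableTopology N)
      (_ : ChartedSpace (EuclideanSpace ℝ (Fin 4)) N) (_ : IsManifold (𝓡 4) ∞ N)
      (_ : CompactSpace N) (_ : SimplyConnectedSpace N),
      Nonempty (SmoothOrientation (𝓡 4) N) :=
  ⟨Metric.sphere (0 : EuclideanSpace ℝ (Fin (4 + 1))) 1, inferInstance, inferInstance, inferInstance, inferInstance, inferInstance, inferInstance,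
    Literature.AlgebraicTopology.FundamentalGroup.simplyConnectedSpace_euclideanSphere 4
      (by norm_num), SmoothOrientation_nonempty_sphere 4⟩

end Context

end Literature.Topology.FourManifolds
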